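import Summits.CriticalPhenomena.PercolationContinuityZ3.Theorems.Transplant.SkelPhiParaCorridorKG
import Summits.CriticalPhenomena.PercolationContinuityZ3.Theorems.Transplant.SkelPhiNegReachRoomsRead
import HarnessLib

/-!
# N2 (frames-only node `SamePDropOfSkeletonFrm₁`, OPEN), (C) column, item (c) of the ROOM rows (lead g11 01:23Z): **THE K-G PRISM NUMERICS** —
# (§1) the fine reading of a run box about an ARBITRARY centre (`fine_sub_ctr_mem_rd`: `runX φ c₀ n h 1 u ∈ Icc lo hi`, `F c₀ = ctr` ⟹
# `rdLo ≤ F u − ctr ≤ rdHi`, N1's `fine_sub_cen_mem_rd` with `P.cen y` replaced by any `ctr`, e.g. `PCells2S.cenS P y`), and (§2) the PRISM of the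
# K-G corridor of record READ IN CLOSED FORM: `y ∈ (kgCorrSched hP₁ hP₂ hsplit).prism` is one of three explicit boxes in the frame coordinates
# (run / across-parking / along-parking: `mem_kgCorrSched_prism_cases`), every region `k` lies in it (`kgCorrSched_region_subset_prism`); with
# `mem_kgCorrSched_core_zero` (start box) and `kgCorrSched_core_last_subset` (arrival box) of SkelPhiParaCorridorKG these are all the frame-side
# readings the geometry rows `hΩball / hreg / hlastM` of `reachChainF_of_kgCorr` need; the planar side (`cenS y + [rdLo, rdHi] ⊆ Q ∪ Hfull`, `⊆ Q ∪ FarNS₂`,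
# `⊆ Mb bv (y+du)`) is PCells2S numerics at the slot values (hp-8 g40 (a) / stmt-g20 (b)).
builds on p205010 (kernel theorem, internal audit signed; external expert review pending) — nothing in this file uses p205010; nothing here is a
claim about the open node `SamePDropOfSkeletonFrm₁`.
Lane `prim-bschramm`, seat `prim-bschramm-p5` (gen 15; (C) lineage); helper file (`--supports stmt-CriticalPhenomena-4575 --as helper`).
[cite: KozmaNitzan2024, §4 Lemma 11 (p. 22: Ω), Lemma 12 (pp. 23–25)] [cite: MartineauTassion2017, §4.3 Lemma 4.2]
-/

noncomputable section

namespace Summit.CriticalPhenomena.PercolationContinuityZ3.Theorems.Transplant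

namespace Skelφ

open Literature.Probability.Percolation Literature.Probability.LatticeModels SimpleGraph
open Literature.Probability.Percolation.KozmaNitzan.Cells (oth)
open ChainPlanar ChainPara
open TwoAxis.Para (modulus)

variable {V : Type} {G : SimpleGraph V} {φ : V → Site 2}

/-- `oth 1 = 0`. [folklore] -/
private theorem oth_one' : oth (1 : Fin 2) = 0 := by decide

/-! ## §1 The fine reading of a run box about an arbitrary centre -/

/-- **A run box read into the fine map at a frame-change vertex, arbitrary centre**: `runX φ c₀ n h 1 u ∈ Icc lo hi` and `F c₀ = ctr` give
`rdLo i ≤ F u i − ctr i ≤ rdHi i` (`F = fineSkel φ t₀ A n h vα vβ c₀′ c₁′ s₀ s₁ D`). [cite: KozmaNitzan2024, §4 Lemma 12 (pp. 23–25)] -/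
theorem fine_sub_ctr_mem_rd {t₀ c₀ : V} {A : ℤ} {n : ℕ} {h vα vβ c₀' c₁' s₀ s₁ D : ℤ} (hA : 0 ≤ A) (hn : 1 ≤ n) (hm : 0 ≤ modulus n h vα vβ)
    (hc₀ : 0 ≤ c₀') (hc₁ : 0 ≤ c₁') (hD : 0 < D) {ctr : Site 2} (hctr : fineSkel φ t₀ A n h vα vβ c₀' c₁' s₀ s₁ D c₀ = ctr)
    {lo hi : Site 2} {u : V} (hu : runX φ c₀ n h 1 u ∈ Finset.Icc lo hi) (i : Fin 2) :
    rdLo A n h vα vβ c₀' c₁' D lo hi i ≤ fineSkel φ t₀ A n h vα vβ c₀' c₁' s₀ s₁ D u i - ctr i ∧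
      fineSkel φ t₀ A n h vα vβ c₀' c₁' s₀ s₁ D u i - ctr i ≤ rdHi A n h vα vβ c₀' c₁' D lo hi i := by
  obtain ⟨⟨h0l, h0u⟩, h1l, h1u⟩ := fine_sub_bounds_of_runX_mem_Icc_signed (s₀ := s₀) (s₁ := s₁) t₀ hA hn hm hc₀ hc₁ hD c₀ hu
  rw [← hctr]
  fin_cases i
  · exact ⟨h0l, h0u⟩
  · exact ⟨h1l, h1u⟩

/-! ## §2 The prism of the K-G corridor of record, in closed form -/

section KG

variable {n ℓ : ℕ} {h v : ℤ} {R' ρ q W N m₁ Wm₂ Wp₂ m₂ : ℕ}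
  (hP₁ : ParkOK (kgPark₁ n ℓ h v R' ρ q W N m₁)) (hP₂ : ParkOK (kgPark₂ n ℓ h v R' ρ q W N m₁ Wm₂ Wp₂ m₂))
  (hsplit : (Wm₂ : ℤ) + Wp₂ = (kgPark₁ n ℓ h v R' ρ q W N m₁).aHi (m₁ + 1) - ParkPrm.aLo (kgPark₁ n ℓ h v R' ρ q W N m₁) (m₁ + 1))

/-- **THE PRISM OF THE K-G CORRIDOR, RECORD LEVEL**: a point of the prism is in the run's prism (axis `0`, origin `0`), or in the across-parking's
(axis `1`, origin `kgC₁`), or in the along-parking's (axis `0`, origin `kgC₂`), each in its record's coordinates. [this work] -/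
theorem mem_kgCorrSched_prism_rec {y : Site 2} (hy : y ∈ (kgCorrSched hP₁ hP₂ hsplit).prism) :
    RunPrm.InPrism (xRunPrmB n ℓ h R' q W N) (y 0) (y 1) ∨
    ParkPrm.InPrism (kgPark₁ n ℓ h v R' ρ q W N m₁) (y 1) (y 0 - ((N : ℤ) + 1) * n) ∨
    ParkPrm.InPrism (kgPark₂ n ℓ h v R' ρ q W N m₁ Wm₂ Wp₂ m₂) (y 0 - ((N : ℤ) + 1) * n)
      (y 1 - ((kgPark₁ n ℓ h v R' ρ q W N m₁).aHi (m₁ + 1) - Wp₂)) := by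
  have hP : (kgCorrSched hP₁ hP₂ hsplit).prism = (xRunPrmB n ℓ h R' q W N).pprism 0 1 0 ∪
      (kgPark₁ n ℓ h v R' ρ q W N m₁).pprism (oth 0) 1 (kgC₁ n N) ∪ (kgPark₂ n ℓ h v R' ρ q W N m₁ Wm₂ Wp₂ m₂).pprism 0 1 (kgC₂ n ℓ h v R' ρ q W N m₁ Wp₂) :=
    (corrSchedNP_params _ _ _ _ _ _ _ _ _ _ _ _ _ _ _ _ _ _ _).2.2.2
  rw [hP, Finset.mem_union, Finset.mem_union] at hy
  rcases hy with (hy | hy) | hy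
  · left
    have h' := (RunPrm.mem_pprism_iff (P := xRunPrmB n ℓ h R' q W N) (a := 0) (c := 0) (Or.inl rfl)).1 hy
    simpa [oth_zero] using h'
  · right; left
    have h' := (ParkPrm.mem_pprism_iff (P := kgPark₁ n ℓ h v R' ρ q W N m₁) (a := oth 0) (c := kgC₁ n N) (Or.inl rfl)).1 hy
    simpa [oth_zero, oth_one', kgC₁] using h'
  · right; right
    have h' := (ParkPrm.mem_pprism_iff (P := kgPark₂ n ℓ h v R' ρ q W N m₁ Wm₂ Wp₂ m₂) (a := 0) (c := kgC₂ n ℓ h v R' ρ q W N m₁ Wp₂)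
      (Or.inl rfl)).1 hy
    simpa [oth_zero, kgC₂] using h'

/-- **THE PRISM OF THE K-G CORRIDOR IN CLOSED FORM** (`U := shearUnit n h`, `P := ⌊nℓ/U⌋ + 1`, `L := ⌊3nℓ/U⌋ + 1`, `A₁ := P + W + (N+1)R′`,
`Wq := q + (N+1)R′`, `g₁ := R′ + ρ + |v|`, `B := Wq + (m₁+1)g₁`): a point `y` of the prism satisfies ONE of
(run) `−(q + (N+1)R′ + n) ≤ y₀ ≤ N n + q + (N+1)R′ + n ∧ |y₁| ≤ P + W + (N+1)R′ + L`;
(across-parking) `min(−A₁, A₁ + 1 − P) − R′ − L ≤ y₁ ≤ A₁ + m₁(R′+ρ) + R′ + L ∧ |y₀ − (N+1)n| ≤ Wq + m₁ g₁ + R′ + n`;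
(along-parking) `min(−B, B + 1 − n) − R′ − n ≤ y₀ − (N+1)n ≤ B + m₂(R′+ρ) + R′ + n ∧
 −Wm₂ − m₂(R′+ρ) − R′ − L ≤ y₁ − (A₁ + (m₁+1)(R′+ρ) − Wp₂) ≤ Wp₂ + m₂(R′+ρ) + R′ + L`. [this work] -/
theorem mem_kgCorrSched_prism_cases {y : Site 2} (hy : y ∈ (kgCorrSched hP₁ hP₂ hsplit).prism) :
    (-((q : ℤ) + (N + 1) * R' + n) ≤ y 0 ∧ y 0 ≤ (N : ℤ) * n + q + (N + 1) * R' + n ∧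
      |y 1| ≤ (n * ℓ / shearUnit n h + 1 + W : ℕ) + ((N : ℤ) + 1) * R' + (3 * (n * ℓ) / shearUnit n h + 1 : ℕ)) ∨
    (min (-((kgA₁ n ℓ h R' W N : ℕ) : ℤ)) ((kgA₁ n ℓ h R' W N : ℕ) + 1 - ((n : ℤ) * ℓ / (shearUnit n h : ℕ) + 1)) - R' -
          (3 * (n * ℓ) / shearUnit n h + 1 : ℕ) ≤ y 1 ∧
      y 1 ≤ (kgA₁ n ℓ h R' W N : ℕ) + (m₁ : ℤ) * (R' + ρ) + R' + (3 * (n * ℓ) / shearUnit n h + 1 : ℕ) ∧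
      |y 0 - ((N : ℤ) + 1) * n| ≤ (q : ℤ) + (N + 1) * R' + m₁ * (R' + ρ + |v|) + R' + n) ∨
    (min (-((q : ℤ) + (N + 1) * R') - ((m₁ : ℤ) + 1) * (R' + ρ + |v|))
          ((q : ℤ) + (N + 1) * R' + ((m₁ : ℤ) + 1) * (R' + ρ + |v|) + 1 - n) - R' - n ≤ y 0 - ((N : ℤ) + 1) * n ∧
      y 0 - ((N : ℤ) + 1) * n ≤ (q : ℤ) + (N + 1) * R' + ((m₁ : ℤ) + 1) * (R' + ρ + |v|) + m₂ * (R' + ρ) + R' + n ∧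
      -(Wm₂ : ℤ) - (m₂ : ℤ) * (R' + ρ) - R' - (3 * (n * ℓ) / shearUnit n h + 1 : ℕ) ≤
          y 1 - (((kgA₁ n ℓ h R' W N : ℕ) : ℤ) + ((m₁ : ℤ) + 1) * (R' + ρ) - Wp₂) ∧
      y 1 - (((kgA₁ n ℓ h R' W N : ℕ) : ℤ) + ((m₁ : ℤ) + 1) * (R' + ρ) - Wp₂) ≤ (Wp₂ : ℤ) + (m₂ : ℤ) * (R' + ρ) + R' + (3 * (n * ℓ) / shearUnit n h + 1 : ℕ)) := by
  have hg₁ : ((kgPark₁ n ℓ h v R' ρ q W N m₁).g : ℤ) = R' + ρ + |v| := by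
    rw [ParkPrm.g_eq]; simp [kgPark₁, yParkPrmW]
  have hg₂ : ((kgPark₂ n ℓ h v R' ρ q W N m₁ Wm₂ Wp₂ m₂).g : ℤ) = R' + ρ := by
    rw [ParkPrm.g_eq]; simp [kgPark₂, xParkPrmW]
  have eHi : (kgPark₁ n ℓ h v R' ρ q W N m₁).aHi (m₁ + 1) = ((kgA₁ n ℓ h R' W N : ℕ) : ℤ) + ((m₁ : ℤ) + 1) * (R' + ρ) := by
    simp only [ParkPrm.aHi, kgPark₁, yParkPrmW]; push_cast; ring
  rcases mem_kgCorrSched_prism_rec hP₁ hP₂ hsplit hy with hr | hp | hp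
  · left
    simp only [RunPrm.InPrism, xRunPrmB, xPrmW, abs_zero, mul_zero, neg_zero, zero_sub, zero_add] at hr
    obtain ⟨h1, h2, h3, h4⟩ := hr
    refine ⟨by linarith, by linarith, abs_le.2 ⟨by push_cast at h3 ⊢; linarith, by push_cast at h4 ⊢; linarith⟩⟩
  · right; left
    simp only [ParkPrm.InPrism, ParkPrm.aBot] at hp
    rw [hg₁] at hp
    simp only [kgPark₁, yParkPrmW] at hp
    obtain ⟨h1, h2, h3, h4⟩ := hp
    push_cast at h1 h2 h3 h4 ⊢
    refine ⟨by linarith, by linarith, abs_le.2 ⟨by linarith, by linarith⟩⟩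
  · right; right
    rw [eHi] at hp
    simp only [ParkPrm.InPrism, ParkPrm.aBot] at hp
    rw [hg₂] at hp
    have hbLo : (kgPark₂ n ℓ h v R' ρ q W N m₁ Wm₂ Wp₂ m₂).aLo0 = -((q : ℤ) + (N + 1) * R') - ((m₁ : ℤ) + 1) * (R' + ρ + |v|) := by
      show (kgPark₁ n ℓ h v R' ρ q W N m₁).bLo (m₁ + 1) = _
      simp only [ParkPrm.bLo]; push_cast; rw [hg₁]; simp [kgPark₁, yParkPrmW]
    have hbHi : (kgPark₂ n ℓ h v R' ρ q W N m₁ Wm₂ Wp₂ m₂).A = (q : ℤ) + (N + 1) * R' + ((m₁ : ℤ) + 1) * (R' + ρ + |v|) := by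
      show (kgPark₁ n ℓ h v R' ρ q W N m₁).bHi (m₁ + 1) = _
      simp only [ParkPrm.bHi]; push_cast; rw [hg₁]; simp [kgPark₁, yParkPrmW]
    rw [hbLo, hbHi] at hp
    simp only [kgPark₂, xParkPrmW] at hp
    obtain ⟨h1, h2, h3, h4⟩ := hp
    push_cast at h1 h2 h3 h4 ⊢
    exact ⟨by linarith, by linarith, by linarith, by linarith⟩

/-- **Every region of the K-G corridor lies in its prism** (so the three boxes of `mem_kgCorrSched_prism_cases` bound every region, every level box
and every core). [folklore] -/
theorem kgCorrSched_region_subset_prism {k : ℕ} (hk : k ≤ (kgCorrSched hP₁ hP₂ hsplit).N) :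
    (kgCorrSched hP₁ hP₂ hsplit).region k ⊆ (kgCorrSched hP₁ hP₂ hsplit).prism :=
  (kgCorrSched hP₁ hP₂ hsplit).sub_prism k hk

end KG

end Skelφ

end Summit.CriticalPhenomena.PercolationContinuityZ3.Theorems.Transplant

end
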